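import Summits.Ventures.LatticeQCDFlow.Exactness.IMHCommonRandomNumbersMeetingTimeMGF
import Summits.Ventures.LatticeQCDFlow.Exactness.IMHCoupledUnbiasedEstimatorUntruncated
import HarnessLib

/-!
# The correction term of the coupled flow-MCMC estimator is rarely anything: `P(|H_{k,N} − f(Y_k)| > (t − 1)(c − a)) ≤ (1 − A)^{k+t−1}·P(X_0 ≠ X′_0)`
# and `E[exp(λ|H_k − f(Y_k)|)] ≤ 1 + (e^{λ(c−a)} − 1)(1 − A)^k·P(X_0 ≠ X′_0)/(1 − e^{λ(c−a)}(1 − A))` — geometric tails, exponential moments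

HONEST FRAMING: exact (Metropolis-corrected) sampling algorithms for lattice gauge theory;
figures of merit are autocorrelation/cost numbers at stated couplings and volumes; no
continuum-physics claim.

Venture `LatticeQCDFlow` (cell pub-lqcd), topic `Exactness`; FANOUT row 30 (lean-1, GEN-39).  NEW WORK of the cell, general state space
with `MeasurableEq Ω`; sequel to GEN-36/37/38's coupled-estimator files (lag-one common-random-numbers pair chain of `K = indepMH q w`,
`H_{k,N} = f(Y_k) + Σ_{n<N} D_{k+n}`, `D_n = f(X′_n) − f(Y_n)`, `a ≤ f ≤ c`; untruncated `H_k`, a `tsum`) and to GEN-38's `…MeetingTimeMGF`.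
Here the LAW of the correction `H − f(Y_k) = Σ D` — the random overhead the coupling adds to the plain read-out `f(Y_k)` — from every
initial coupling `μ̂₀` (`p₀ = μ̂₀(Δᶜ) = P(X_0 ≠ X′_0)`, `W = w(x₀)`, `r = 1 − 1/W`):

* §1 (pathwise) **`abs_correction_le_indicator`** — `|D_n| ≤ (c − a)·1{z_n ∉ Δ}`; **`abs_sum_corrections_le_count`** —
  `|Σ_{n<N} D_{k+n}| ≤ (c − a)·#{n < N : z_{k+n} ∉ Δ}`; **`merged_stay_shift`** [bookkeeping].
* §2 GEOMETRIC TAILS: **`crnLag_correction_tail_le`** — `P(|Σ_{n<N} D_{k+n}| > (t − 1)(c − a)) ≤ r^{k+t−1}·p₀` for every `t ≥ 1`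
  and every `N` (a correction larger than `t − 1` ranges needs the runs to differ at time `k + t − 1`); **`crnLag_correction_ne_zero_le`**
  — `P(Σ_{n<N} D_{k+n} ≠ 0) ≤ r^k·p₀`: after `k` burn-in updates the coupled estimate IS the plain read-out except on an event of
  probability `≤ r^k`.
* §3 EXPONENTIAL MOMENTS: **`crn_chain_integral_shiftCount_mgf_eq`** ∕ **`_le`** — the generating function of the disagreement count on
  the window `[k, k + N)`, `≤ 1 + (s − 1)·r^k p₀/(1 − s r)` for `1 ≤ s`, `s r < 1`; **`crnLag_integral_exp_abs_correction_le`** — for `λ ≥ 0`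
  with `e^{λ(c−a)} r < 1`: `E[exp(λ|Σ_{n<N} D_{k+n}|)] ≤ 1 + (e^{λ(c−a)} − 1)·r^k p₀/(1 − e^{λ(c−a)} r)` UNIFORMLY IN `N`.
* §4 **`crnLag_integral_exp_abs_tsum_correction_le`** (+ integrability) — the same bound for `E[exp(λ|H_k − f(Y_k)|)]` (Fatou): the exactly
  unbiased estimator differs from the plain read-out by a term with exponential moments of every order `λ < log(1/r)/(c − a)`.
Reading (gauge files): the burn-in-free estimator of two exact gauge samplers on one stream of random numbers equals the plain measurement
except with probability `≤ (1 − A)^k` and exceeds it by more than `m` ranges with probability `≤ (1 − A)^{k+m}`.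
NOT CLAIMED: a Chernoff bound across replicas; lower bounds; unbounded `f`; two proposals; any value of `A`.  No `sorry`, no `def`, no cited fact.
-/

noncomputable section

namespace Summit.Ventures.LatticeQCDFlow.Exactness

open MeasureTheory ProbabilityTheory Function Finset Filter
open scoped ENNReal unitInterval Topology
open Summit.Ventures.LatticeQCDFlow.Scoring

variable {Ω : Type*} [MeasurableSpace Ω] {q : Measure Ω} [IsProbabilityMeasure q] {w : Ω → ℝ}

/-! ## §1 Pathwise: the correction is dominated by the disagreement count -/

omit [MeasurableSpace Ω] in
/-- `|f(p.1) − f(p.2)| ≤ (c − a)·1{p ∉ Δ}` for `a ≤ f ≤ c`. [ours, bookkeeping] -/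
theorem abs_correction_le_indicator {f : Ω → ℝ} {a c : ℝ} (ha : ∀ x, a ≤ f x) (hc : ∀ x, f x ≤ c) (p : Ω × Ω) :
    |f p.1 - f p.2| ≤ (c - a) * (Set.diagonal Ω)ᶜ.indicator (1 : Ω × Ω → ℝ) p := by
  by_cases hp : p ∈ (Set.diagonal Ω)ᶜ
  · rw [Set.indicator_of_mem hp, Pi.one_apply, mul_one]
    exact abs_sub_le_iff.2 ⟨by linarith [hc p.1, ha p.2], by linarith [hc p.2, ha p.1]⟩
  · have h : p.1 = p.2 := Set.mem_diagonal_iff.1 (not_not.1 (fun h => hp h))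
    rw [Set.indicator_of_notMem hp, mul_zero, h, sub_self, abs_zero]

omit [MeasurableSpace Ω] in
/-- `|Σ_{n<N} (f((z(k+n)).1) − f((z(k+n)).2))| ≤ (c − a)·Σ_{n<N} 1{z(k+n) ∉ Δ}`. [ours, bookkeeping] -/
theorem abs_sum_corrections_le_count {f : Ω → ℝ} {a c : ℝ} (ha : ∀ x, a ≤ f x) (hc : ∀ x, f x ≤ c) (z : ℕ → Ω × Ω)
    (k N : ℕ) :
    |∑ n ∈ Finset.range N, (f ((z (k + n)).1) - f ((z (k + n)).2))| ≤
      (c - a) * ∑ n ∈ Finset.range N, (Set.diagonal Ω)ᶜ.indicator (1 : Ω × Ω → ℝ) (z (k + n)) := by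
  rw [mul_sum]
  exact (abs_sum_le_sum_abs _ _).trans (sum_le_sum fun n _ => abs_correction_le_indicator ha hc (z (k + n)))

omit [MeasurableSpace Ω] in
/-- If merged runs stay merged along `z`, the same holds along the shifted path `n ↦ z(k + n)`. [ours, bookkeeping] -/
theorem merged_stay_shift {z : ℕ → Ω × Ω} (hz : ∀ n m, n ≤ m → z n ∈ Set.diagonal Ω → z m ∈ Set.diagonal Ω) (k : ℕ) :
    ∀ n m, n ≤ m → z (k + n) ∈ Set.diagonal Ω → z (k + m) ∈ Set.diagonal Ω :=
  fun n m hnm h => hz (k + n) (k + m) (Nat.add_le_add_left hnm k) h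

omit [MeasurableSpace Ω] in
/-- `|1{p ∉ Δ}| ≤ 1`. [ours, bookkeeping] -/
theorem abs_indicator_offDiagonal_le_one (p : Ω × Ω) : |(Set.diagonal Ω)ᶜ.indicator (1 : Ω × Ω → ℝ) p| ≤ 1 := by
  by_cases hp : p ∈ (Set.diagonal Ω)ᶜ
  · rw [Set.indicator_of_mem hp, Pi.one_apply, abs_one]
  · rw [Set.indicator_of_notMem hp, abs_zero]; exact zero_le_one

/-- Measurability of `exp(l·|Σ_{n<N} D_{k+n}|)` on pair-path space. [ours, bookkeeping] -/
theorem measurable_exp_abs_sum_corrections {f : Ω → ℝ} (hf : Measurable f) (k N : ℕ) (l : ℝ) :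
    Measurable fun z : ℕ → Ω × Ω => Real.exp (l * |∑ n ∈ Finset.range N, (f ((z (k + n)).1) - f ((z (k + n)).2))|) :=
  Real.measurable_exp.comp (measurable_const.mul (Finset.measurable_sum _ fun n _ =>
    (hf.comp (measurable_fst.comp (measurable_pi_apply (k + n)))).sub (hf.comp (measurable_snd.comp (measurable_pi_apply (k + n))))).abs)

/-- `exp(l·|Σ_{n<N} D_{k+n}|)` is bounded by `exp(l·N(c − a))`, hence integrable under every finite measure (`l ≥ 0`). [ours, bookkeeping] -/
theorem integrable_exp_abs_sum_corrections {f : Ω → ℝ} (hf : Measurable f) {a c : ℝ} (ha : ∀ x, a ≤ f x) (hc : ∀ x, f x ≤ c)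
    (k N : ℕ) {l : ℝ} (hl : 0 ≤ l) (P : Measure (ℕ → Ω × Ω)) [IsFiniteMeasure P] :
    Integrable (fun z : ℕ → Ω × Ω => Real.exp (l * |∑ n ∈ Finset.range N, (f ((z (k + n)).1) - f ((z (k + n)).2))|)) P := by
  refine integrable_of_bounded P (measurable_exp_abs_sum_corrections hf k N l) (C := Real.exp (l * (N * (c - a)))) (fun z => ?_)
  rw [abs_of_nonneg (Real.exp_nonneg _)]
  refine Real.exp_le_exp.2 (mul_le_mul_of_nonneg_left ?_ hl)
  have hca : 0 ≤ c - a := by linarith [ha (z k).1, hc (z k).1]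
  calc |∑ n ∈ Finset.range N, (f ((z (k + n)).1) - f ((z (k + n)).2))|
      ≤ (c - a) * ∑ n ∈ Finset.range N, (Set.diagonal Ω)ᶜ.indicator (1 : Ω × Ω → ℝ) (z (k + n)) :=
        abs_sum_corrections_le_count ha hc z k N
    _ ≤ (c - a) * ∑ n ∈ Finset.range N, (1 : ℝ) :=
        mul_le_mul_of_nonneg_left (sum_le_sum fun n _ => Set.indicator_le_self' (fun _ _ => zero_le_one) _) hca
    _ = N * (c - a) := by rw [sum_const, card_range, nsmul_eq_mul, mul_one, mul_comm]

/-! ## §2 Geometric tails of the correction -/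

/-- **`P(|Σ_{n<N} D_{k+n}| > (t − 1)(c − a)) ≤ r^{k+t−1}·P(X_0 ≠ X′_0)`** for every `t ≥ 1` and every `N`, from every initial coupling
(`w` normalised, maximal at `x₀`, `r = 1 − 1/w(x₀)`): a correction exceeding `t − 1` ranges forces the runs to differ at time `k + t − 1`.
[ours] -/
theorem crnLag_correction_tail_le [MeasurableEq Ω] (hw : Measurable w) (hw0 : ∀ y, 0 < w y) {x₀ : Ω}
    (hmax : ∀ y, w y ≤ w x₀) [IsProbabilityMeasure (q.withDensity fun y => ENNReal.ofReal (w y))]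
    (Khat : Kernel (Ω × Ω) (Ω × Ω)) [IsMarkovKernel Khat]
    (hK : ∀ z : Ω × Ω, Khat z = (q.prod (volume : Measure unitInterval)).map (fun p : Ω × unitInterval =>
      ((if (p.2 : ℝ) * w z.1 ≤ w p.1 then p.1 else z.1), (if (p.2 : ℝ) * w z.2 ≤ w p.1 then p.1 else z.2))))
    (μ₀ : Measure (Ω × Ω)) [IsProbabilityMeasure μ₀] {f : Ω → ℝ} {a c : ℝ} (ha : ∀ x, a ≤ f x) (hc : ∀ x, f x ≤ c)
    (k N : ℕ) {t : ℕ} (ht : 1 ≤ t) :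
    (Kernel.trajMeasure (X := fun _ : ℕ => Ω × Ω) μ₀
          (fun n : ℕ => Khat.comap (fun h : (i : ↥(Finset.Iic n)) → Ω × Ω => h ⟨n, Finset.mem_Iic.2 le_rfl⟩)
            (measurable_pi_apply _))).real
        {z | (c - a) * ((t : ℝ) - 1) < |∑ n ∈ Finset.range N, (f ((z (k + n)).1) - f ((z (k + n)).2))|} ≤
      (1 - (w x₀)⁻¹) ^ (k + t - 1) * μ₀.real (Set.diagonal Ω)ᶜ := by
  set P := Kernel.trajMeasure (X := fun _ : ℕ => Ω × Ω) μ₀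
      (fun n : ℕ => Khat.comap (fun h : (i : ↥(Finset.Iic n)) → Ω × Ω => h ⟨n, Finset.mem_Iic.2 le_rfl⟩)
        (measurable_pi_apply _)) with hP
  have hca : 0 ≤ c - a := by linarith [ha x₀, hc x₀]
  -- a.e.: on the event the shifted disagreement count is `≥ t`, so the runs differ at time `k + t − 1`
  have hsub : P {z | (c - a) * ((t : ℝ) - 1) < |∑ n ∈ Finset.range N, (f ((z (k + n)).1) - f ((z (k + n)).2))|} ≤
      P {z | z (k + t - 1) ∉ Set.diagonal Ω} := by
    refine measure_mono_ae ?_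
    filter_upwards [crn_chain_ae_merged_stay hw hw0 Khat hK μ₀] with z hz
    intro hlt
    have hle := abs_sum_corrections_le_count ha hc z k N
    have hlt' : (c - a) * ((t : ℝ) - 1) < (c - a) * ∑ n ∈ Finset.range N, (Set.diagonal Ω)ᶜ.indicator (1 : Ω × Ω → ℝ) (z (k + n)) :=
      hlt.trans_le hle
    have hca' : 0 < c - a := by
      rcases hca.lt_or_eq with h | h
      · exact h
      · rw [← h, zero_mul, zero_mul] at hlt'; exact absurd hlt' (lt_irrefl _)
    have hcount : (t : ℝ) - 1 < ∑ n ∈ Finset.range N, (Set.diagonal Ω)ᶜ.indicator (1 : Ω × Ω → ℝ) (z (k + n)) :=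
      lt_of_mul_lt_mul_left hlt' hca
    -- the count is an integer: `> t − 1` means `≥ t`
    have hnat : ∑ n ∈ Finset.range N, (Set.diagonal Ω)ᶜ.indicator (1 : Ω × Ω → ℝ) (z (k + n)) =
        ((∑ n ∈ Finset.range N, (Set.diagonal Ω)ᶜ.indicator (1 : Ω × Ω → ℕ) (z (k + n)) : ℕ) : ℝ) := by
      rw [Nat.cast_sum]
      refine sum_congr rfl fun n _ => ?_
      by_cases hp : z (k + n) ∈ (Set.diagonal Ω)ᶜ
      · rw [Set.indicator_of_mem hp, Set.indicator_of_mem hp, Pi.one_apply, Pi.one_apply, Nat.cast_one]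
      · rw [Set.indicator_of_notMem hp, Set.indicator_of_notMem hp, Nat.cast_zero]
    have hge : (t : ℝ) ≤ ∑ n ∈ Finset.range N, (Set.diagonal Ω)ᶜ.indicator (1 : Ω × Ω → ℝ) (z (k + n)) := by
      rw [hnat] at hcount ⊢
      have h1 : ((t : ℝ) - 1) = ((t - 1 : ℕ) : ℝ) := by rw [Nat.cast_sub ht, Nat.cast_one]
      rw [h1] at hcount
      exact_mod_cast Nat.le_of_pred_lt (by exact_mod_cast hcount)
    have h := offDiagonal_of_le_disagreementCount (merged_stay_shift hz k) ht hge
    rwa [show k + (t - 1) = k + t - 1 from (Nat.add_sub_assoc ht k).symm] at h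
  calc P.real {z | (c - a) * ((t : ℝ) - 1) < |∑ n ∈ Finset.range N, (f ((z (k + n)).1) - f ((z (k + n)).2))|}
      ≤ P.real {z | z (k + t - 1) ∉ Set.diagonal Ω} := by
        simp only [measureReal_def]; exact ENNReal.toReal_mono (measure_ne_top _ _) hsub
    _ = ((fun m : Measure (Ω × Ω) => m.bind Khat)^[k + t - 1] μ₀).real (Set.diagonal Ω)ᶜ := by
        rw [hP]; exact crn_chain_offDiagonal_real_eq Khat μ₀ (k + t - 1)
    _ ≤ (1 - (w x₀)⁻¹) ^ (k + t - 1) * μ₀.real (Set.diagonal Ω)ᶜ :=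
        iterate_bind_crnPair_offDiagonal_le hw hw0 hmax Khat hK (k + t - 1) μ₀

/-- **`P(Σ_{n<N} D_{k+n} ≠ 0) ≤ r^k·P(X_0 ≠ X′_0)`**: after `k` burn-in updates the coupled estimate `H_{k,N}` IS the plain read-out
`f(Y_k)` except on an event of probability at most `r^k` (times the initial disagreement probability). [ours] -/
theorem crnLag_correction_ne_zero_le [MeasurableEq Ω] (hw : Measurable w) (hw0 : ∀ y, 0 < w y) {x₀ : Ω}
    (hmax : ∀ y, w y ≤ w x₀) [IsProbabilityMeasure (q.withDensity fun y => ENNReal.ofReal (w y))]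
    (Khat : Kernel (Ω × Ω) (Ω × Ω)) [IsMarkovKernel Khat]
    (hK : ∀ z : Ω × Ω, Khat z = (q.prod (volume : Measure unitInterval)).map (fun p : Ω × unitInterval =>
      ((if (p.2 : ℝ) * w z.1 ≤ w p.1 then p.1 else z.1), (if (p.2 : ℝ) * w z.2 ≤ w p.1 then p.1 else z.2))))
    (μ₀ : Measure (Ω × Ω)) [IsProbabilityMeasure μ₀] {f : Ω → ℝ} {a c : ℝ} (ha : ∀ x, a ≤ f x) (hc : ∀ x, f x ≤ c)
    (k N : ℕ) :
    (Kernel.trajMeasure (X := fun _ : ℕ => Ω × Ω) μ₀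
          (fun n : ℕ => Khat.comap (fun h : (i : ↥(Finset.Iic n)) → Ω × Ω => h ⟨n, Finset.mem_Iic.2 le_rfl⟩)
            (measurable_pi_apply _))).real
        {z | ∑ n ∈ Finset.range N, (f ((z (k + n)).1) - f ((z (k + n)).2)) ≠ 0} ≤
      (1 - (w x₀)⁻¹) ^ k * μ₀.real (Set.diagonal Ω)ᶜ := by
  have h := crnLag_correction_tail_le hw hw0 hmax Khat hK μ₀ ha hc k N (t := 1) le_rfl
  have hset : {z : ℕ → Ω × Ω | ∑ n ∈ Finset.range N, (f ((z (k + n)).1) - f ((z (k + n)).2)) ≠ 0} =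
      {z | (c - a) * (((1 : ℕ) : ℝ) - 1) < |∑ n ∈ Finset.range N, (f ((z (k + n)).1) - f ((z (k + n)).2))|} := by
    ext z
    simp only [Set.mem_setOf_eq, Nat.cast_one, sub_self, mul_zero, abs_pos]
  rw [hset]
  simpa only [Nat.add_sub_cancel] using h

/-! ## §3 Exponential moments of the truncated correction -/

/-- **THE GENERATING FUNCTION OF THE DISAGREEMENT COUNT ON THE WINDOW `[k, k + N)`**:
`E[1 + (s − 1)Σ_{n<N} sⁿ 1{Z_{k+n} ∉ Δ}] = 1 + (s − 1)Σ_{n<N} sⁿ P(X_{k+n} ≠ X′_{k+n})` from every initial coupling, every real `s`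
(the integrand is `s^{#{n<N : Z_{k+n} ∉ Δ}}` on almost every path, by `pow_disagreementCount_eq` along the shifted path). [ours] -/
theorem crn_chain_integral_shiftCount_mgf_eq [MeasurableEq Ω] (Khat : Kernel (Ω × Ω) (Ω × Ω)) [IsMarkovKernel Khat]
    (μ₀ : Measure (Ω × Ω)) [IsProbabilityMeasure μ₀] (s : ℝ) (k N : ℕ) :
    ∫ z, (1 + (s - 1) * ∑ n ∈ Finset.range N, s ^ n * (Set.diagonal Ω)ᶜ.indicator (1 : Ω × Ω → ℝ) (z (k + n)))
        ∂(Kernel.trajMeasure (X := fun _ : ℕ => Ω × Ω) μ₀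
          (fun n : ℕ => Khat.comap (fun h : (i : ↥(Finset.Iic n)) → Ω × Ω => h ⟨n, Finset.mem_Iic.2 le_rfl⟩)
            (measurable_pi_apply _))) =
      1 + (s - 1) * ∑ n ∈ Finset.range N, s ^ n * ((fun m : Measure (Ω × Ω) => m.bind Khat)^[k + n] μ₀).real (Set.diagonal Ω)ᶜ := by
  set P := Kernel.trajMeasure (X := fun _ : ℕ => Ω × Ω) μ₀
      (fun n : ℕ => Khat.comap (fun h : (i : ↥(Finset.Iic n)) → Ω × Ω => h ⟨n, Finset.mem_Iic.2 le_rfl⟩)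
        (measurable_pi_apply _)) with hP
  have hD : MeasurableSet (Set.diagonal Ω) := measurableSet_diagonal
  have hIm : Measurable ((Set.diagonal Ω)ᶜ.indicator (1 : Ω × Ω → ℝ)) := measurable_one.indicator hD.compl
  have hIb : ∀ p : Ω × Ω, |(Set.diagonal Ω)ᶜ.indicator (1 : Ω × Ω → ℝ) p| ≤ 1 := abs_indicator_offDiagonal_le_one
  have hIi : ∀ n, Integrable (fun z : ℕ → Ω × Ω => (Set.diagonal Ω)ᶜ.indicator (1 : Ω × Ω → ℝ) (z (k + n))) P := fun n =>
    integrable_of_bounded P (hIm.comp (measurable_pi_apply (k + n))) (fun z => hIb _)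
  have hSi : Integrable (fun z : ℕ → Ω × Ω =>
      ∑ n ∈ Finset.range N, s ^ n * (Set.diagonal Ω)ᶜ.indicator (1 : Ω × Ω → ℝ) (z (k + n))) P :=
    integrable_finsetSum _ fun n _ => (hIi n).const_mul _
  rw [integral_add (integrable_const _) (hSi.const_mul _), integral_const, probReal_univ, one_smul, integral_const_mul,
    integral_finsetSum _ fun n _ => (hIi n).const_mul _]
  congr 2
  refine sum_congr rfl fun n _ => ?_
  rw [integral_const_mul, hP, chain_expect_eq_integral_iterate_bind Khat μ₀ hIm hIb (k + n), integral_indicator_one hD.compl]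

/-- **`≤ 1 + (s − 1)·r^k·P(X_0 ≠ X′_0)/(1 − s r)`** for `1 ≤ s` and `s r < 1`, uniformly in `N` (`w` normalised, maximal at `x₀`,
`r = 1 − 1/w(x₀)`). [ours] -/
theorem crn_chain_integral_shiftCount_mgf_le [MeasurableEq Ω] (hw : Measurable w) (hw0 : ∀ y, 0 < w y) {x₀ : Ω}
    (hmax : ∀ y, w y ≤ w x₀) [IsProbabilityMeasure (q.withDensity fun y => ENNReal.ofReal (w y))]
    (Khat : Kernel (Ω × Ω) (Ω × Ω)) [IsMarkovKernel Khat]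
    (hK : ∀ z : Ω × Ω, Khat z = (q.prod (volume : Measure unitInterval)).map (fun p : Ω × unitInterval =>
      ((if (p.2 : ℝ) * w z.1 ≤ w p.1 then p.1 else z.1), (if (p.2 : ℝ) * w z.2 ≤ w p.1 then p.1 else z.2))))
    (μ₀ : Measure (Ω × Ω)) [IsProbabilityMeasure μ₀] {s : ℝ} (hs : 1 ≤ s) (hsr : s * (1 - (w x₀)⁻¹) < 1) (k N : ℕ) :
    ∫ z, (1 + (s - 1) * ∑ n ∈ Finset.range N, s ^ n * (Set.diagonal Ω)ᶜ.indicator (1 : Ω × Ω → ℝ) (z (k + n)))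
        ∂(Kernel.trajMeasure (X := fun _ : ℕ => Ω × Ω) μ₀
          (fun n : ℕ => Khat.comap (fun h : (i : ↥(Finset.Iic n)) → Ω × Ω => h ⟨n, Finset.mem_Iic.2 le_rfl⟩)
            (measurable_pi_apply _))) ≤
      1 + (s - 1) * ((1 - (w x₀)⁻¹) ^ k * μ₀.real (Set.diagonal Ω)ᶜ / (1 - s * (1 - (w x₀)⁻¹))) := by
  rw [crn_chain_integral_shiftCount_mgf_eq Khat μ₀ s k N]
  have hs0 : 0 ≤ s := zero_le_one.trans hs
  have hW : 1 ≤ w x₀ := one_le_of_mode (q := q) hmax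
  have hr0 : 0 ≤ 1 - (w x₀)⁻¹ := sub_nonneg.2 (inv_le_one_of_one_le₀ hW)
  have hsr0 : 0 ≤ s * (1 - (w x₀)⁻¹) := mul_nonneg hs0 hr0
  have hp0 : 0 ≤ (1 - (w x₀)⁻¹) ^ k * μ₀.real (Set.diagonal Ω)ᶜ := mul_nonneg (pow_nonneg hr0 k) measureReal_nonneg
  have hterm : ∀ n ∈ Finset.range N, s ^ n * ((fun m : Measure (Ω × Ω) => m.bind Khat)^[k + n] μ₀).real (Set.diagonal Ω)ᶜ ≤
      (1 - (w x₀)⁻¹) ^ k * μ₀.real (Set.diagonal Ω)ᶜ * (s * (1 - (w x₀)⁻¹)) ^ n := fun n _ =>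
    calc s ^ n * ((fun m : Measure (Ω × Ω) => m.bind Khat)^[k + n] μ₀).real (Set.diagonal Ω)ᶜ
        ≤ s ^ n * ((1 - (w x₀)⁻¹) ^ (k + n) * μ₀.real (Set.diagonal Ω)ᶜ) :=
          mul_le_mul_of_nonneg_left (iterate_bind_crnPair_offDiagonal_le hw hw0 hmax Khat hK (k + n) μ₀) (pow_nonneg hs0 n)
      _ = (1 - (w x₀)⁻¹) ^ k * μ₀.real (Set.diagonal Ω)ᶜ * (s * (1 - (w x₀)⁻¹)) ^ n := by rw [pow_add, mul_pow]; ring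
  have hsum : ∑ n ∈ Finset.range N, s ^ n * ((fun m : Measure (Ω × Ω) => m.bind Khat)^[k + n] μ₀).real (Set.diagonal Ω)ᶜ ≤
      (1 - (w x₀)⁻¹) ^ k * μ₀.real (Set.diagonal Ω)ᶜ / (1 - s * (1 - (w x₀)⁻¹)) := by
    refine (sum_le_sum hterm).trans ?_
    rw [← mul_sum, div_eq_mul_inv]
    exact mul_le_mul_of_nonneg_left
      (sum_le_hasSum (range N) (fun n _ => pow_nonneg hsr0 n) (hasSum_geometric_of_lt_one hsr0 hsr)) hp0
  have hs1 : 0 ≤ s - 1 := sub_nonneg.2 hs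
  nlinarith

/-- **EXPONENTIAL MOMENTS OF THE CORRECTION, UNIFORMLY IN `N`**: for `λ ≥ 0` with `e^{λ(c−a)}·r < 1`,
`E[exp(λ|Σ_{n<N} D_{k+n}|)] ≤ 1 + (e^{λ(c−a)} − 1)·r^k·P(X_0 ≠ X′_0)/(1 − e^{λ(c−a)} r)` from every initial coupling (`a ≤ f ≤ c`
measurable). [ours] -/
theorem crnLag_integral_exp_abs_correction_le [MeasurableEq Ω] (hw : Measurable w) (hw0 : ∀ y, 0 < w y) {x₀ : Ω}
    (hmax : ∀ y, w y ≤ w x₀) [IsProbabilityMeasure (q.withDensity fun y => ENNReal.ofReal (w y))]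
    (Khat : Kernel (Ω × Ω) (Ω × Ω)) [IsMarkovKernel Khat]
    (hK : ∀ z : Ω × Ω, Khat z = (q.prod (volume : Measure unitInterval)).map (fun p : Ω × unitInterval =>
      ((if (p.2 : ℝ) * w z.1 ≤ w p.1 then p.1 else z.1), (if (p.2 : ℝ) * w z.2 ≤ w p.1 then p.1 else z.2))))
    (μ₀ : Measure (Ω × Ω)) [IsProbabilityMeasure μ₀] {f : Ω → ℝ} (hf : Measurable f) {a c : ℝ} (ha : ∀ x, a ≤ f x)
    (hc : ∀ x, f x ≤ c) (k N : ℕ) {l : ℝ} (hl : 0 ≤ l) (hlr : Real.exp (l * (c - a)) * (1 - (w x₀)⁻¹) < 1) :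
    ∫ z, Real.exp (l * |∑ n ∈ Finset.range N, (f ((z (k + n)).1) - f ((z (k + n)).2))|)
        ∂(Kernel.trajMeasure (X := fun _ : ℕ => Ω × Ω) μ₀
          (fun n : ℕ => Khat.comap (fun h : (i : ↥(Finset.Iic n)) → Ω × Ω => h ⟨n, Finset.mem_Iic.2 le_rfl⟩)
            (measurable_pi_apply _))) ≤
      1 + (Real.exp (l * (c - a)) - 1) * ((1 - (w x₀)⁻¹) ^ k * μ₀.real (Set.diagonal Ω)ᶜ /
        (1 - Real.exp (l * (c - a)) * (1 - (w x₀)⁻¹))) := by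
  set P := Kernel.trajMeasure (X := fun _ : ℕ => Ω × Ω) μ₀
      (fun n : ℕ => Khat.comap (fun h : (i : ↥(Finset.Iic n)) → Ω × Ω => h ⟨n, Finset.mem_Iic.2 le_rfl⟩)
        (measurable_pi_apply _)) with hP
  set s := Real.exp (l * (c - a)) with hsdef
  have hca : 0 ≤ c - a := by linarith [ha x₀, hc x₀]
  have hs : 1 ≤ s := Real.one_le_exp (mul_nonneg hl hca)
  have hD : MeasurableSet (Set.diagonal Ω) := measurableSet_diagonal
  have hIm : Measurable ((Set.diagonal Ω)ᶜ.indicator (1 : Ω × Ω → ℝ)) := measurable_one.indicator hD.compl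
  have hIb : ∀ p : Ω × Ω, |(Set.diagonal Ω)ᶜ.indicator (1 : Ω × Ω → ℝ) p| ≤ 1 := abs_indicator_offDiagonal_le_one
  have hEi := integrable_exp_abs_sum_corrections hf ha hc k N hl P
  -- the real spelling of `s^{count}` on the window, integrable
  have hIi : ∀ n, Integrable (fun z : ℕ → Ω × Ω => (Set.diagonal Ω)ᶜ.indicator (1 : Ω × Ω → ℝ) (z (k + n))) P := fun n =>
    integrable_of_bounded P (hIm.comp (measurable_pi_apply (k + n))) (fun z => hIb _)
  have hgi : Integrable (fun z : ℕ → Ω × Ω =>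
      1 + (s - 1) * ∑ n ∈ Finset.range N, s ^ n * (Set.diagonal Ω)ᶜ.indicator (1 : Ω × Ω → ℝ) (z (k + n))) P :=
    (integrable_const _).add ((integrable_finsetSum _ fun n _ => (hIi n).const_mul _).const_mul _)
  -- a.e. domination: `exp(l|Σ D|) ≤ exp(l(c − a))^{count} = 1 + (s − 1)Σ sⁿ 1{…}`
  have hdom : ∀ᵐ z ∂P, Real.exp (l * |∑ n ∈ Finset.range N, (f ((z (k + n)).1) - f ((z (k + n)).2))|) ≤
      1 + (s - 1) * ∑ n ∈ Finset.range N, s ^ n * (Set.diagonal Ω)ᶜ.indicator (1 : Ω × Ω → ℝ) (z (k + n)) := by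
    filter_upwards [crn_chain_ae_merged_stay hw hw0 Khat hK μ₀] with z hz
    have hnat : ∑ n ∈ Finset.range N, (Set.diagonal Ω)ᶜ.indicator (1 : Ω × Ω → ℝ) (z (k + n)) =
        ((∑ n ∈ Finset.range N, (Set.diagonal Ω)ᶜ.indicator (1 : Ω × Ω → ℕ) (z (k + n)) : ℕ) : ℝ) := by
      rw [Nat.cast_sum]
      refine sum_congr rfl fun n _ => ?_
      by_cases hp : z (k + n) ∈ (Set.diagonal Ω)ᶜ
      · rw [Set.indicator_of_mem hp, Set.indicator_of_mem hp, Pi.one_apply, Pi.one_apply, Nat.cast_one]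
      · rw [Set.indicator_of_notMem hp, Set.indicator_of_notMem hp, Nat.cast_zero]
    rw [← pow_disagreementCount_eq (merged_stay_shift hz k) s N]
    calc Real.exp (l * |∑ n ∈ Finset.range N, (f ((z (k + n)).1) - f ((z (k + n)).2))|)
        ≤ Real.exp (l * ((c - a) * ∑ n ∈ Finset.range N, (Set.diagonal Ω)ᶜ.indicator (1 : Ω × Ω → ℝ) (z (k + n)))) :=
          Real.exp_le_exp.2 (mul_le_mul_of_nonneg_left (abs_sum_corrections_le_count ha hc z k N) hl)
      _ = s ^ (∑ n ∈ Finset.range N, (Set.diagonal Ω)ᶜ.indicator (1 : Ω × Ω → ℕ) (z (k + n))) := by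
          rw [hnat, ← mul_assoc, mul_comm (l * (c - a)), Real.exp_nat_mul]
  refine (integral_mono_ae hEi hgi hdom).trans ?_
  rw [hP]
  exact crn_chain_integral_shiftCount_mgf_le hw hw0 hmax Khat hK μ₀ hs hlr k N

/-! ## §4 The untruncated correction: the same exponential moments -/

/-- **`∫⁻ exp(λ|Σ' D_{k+n}|) ≤ 1 + (e^{λ(c−a)} − 1)·r^k·P(X_0 ≠ X′_0)/(1 − e^{λ(c−a)} r)`** (extended-real form; Fatou along the truncations)
for `λ ≥ 0` with `e^{λ(c−a)} r < 1`. [ours] -/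
theorem crnLag_lintegral_exp_abs_tsum_correction_le [MeasurableEq Ω] (hw : Measurable w) (hw0 : ∀ y, 0 < w y) {x₀ : Ω}
    (hmax : ∀ y, w y ≤ w x₀) [IsProbabilityMeasure (q.withDensity fun y => ENNReal.ofReal (w y))]
    (Khat : Kernel (Ω × Ω) (Ω × Ω)) [IsMarkovKernel Khat]
    (hK : ∀ z : Ω × Ω, Khat z = (q.prod (volume : Measure unitInterval)).map (fun p : Ω × unitInterval =>
      ((if (p.2 : ℝ) * w z.1 ≤ w p.1 then p.1 else z.1), (if (p.2 : ℝ) * w z.2 ≤ w p.1 then p.1 else z.2))))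
    (μ₀ : Measure (Ω × Ω)) [IsProbabilityMeasure μ₀] {f : Ω → ℝ} (hf : Measurable f) {a c : ℝ} (ha : ∀ x, a ≤ f x)
    (hc : ∀ x, f x ≤ c) (k : ℕ) {l : ℝ} (hl : 0 ≤ l) (hlr : Real.exp (l * (c - a)) * (1 - (w x₀)⁻¹) < 1) :
    ∫⁻ z, ENNReal.ofReal (Real.exp (l * |∑' n, (f ((z (k + n)).1) - f ((z (k + n)).2))|))
        ∂(Kernel.trajMeasure (X := fun _ : ℕ => Ω × Ω) μ₀
          (fun n : ℕ => Khat.comap (fun h : (i : ↥(Finset.Iic n)) → Ω × Ω => h ⟨n, Finset.mem_Iic.2 le_rfl⟩)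
            (measurable_pi_apply _))) ≤
      ENNReal.ofReal (1 + (Real.exp (l * (c - a)) - 1) * ((1 - (w x₀)⁻¹) ^ k * μ₀.real (Set.diagonal Ω)ᶜ /
        (1 - Real.exp (l * (c - a)) * (1 - (w x₀)⁻¹)))) := by
  set P := Kernel.trajMeasure (X := fun _ : ℕ => Ω × Ω) μ₀
      (fun n : ℕ => Khat.comap (fun h : (i : ↥(Finset.Iic n)) → Ω × Ω => h ⟨n, Finset.mem_Iic.2 le_rfl⟩)
        (measurable_pi_apply _)) with hP
  have hEm : ∀ N, Measurable fun z : ℕ → Ω × Ω =>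
      Real.exp (l * |∑ n ∈ Finset.range N, (f ((z (k + n)).1) - f ((z (k + n)).2))|) := fun N =>
    measurable_exp_abs_sum_corrections hf k N l
  have hEi : ∀ N, Integrable (fun z : ℕ → Ω × Ω =>
      Real.exp (l * |∑ n ∈ Finset.range N, (f ((z (k + n)).1) - f ((z (k + n)).2))|)) P := fun N =>
    integrable_exp_abs_sum_corrections hf ha hc k N hl P
  have hbound : ∀ N, ∫ z, Real.exp (l * |∑ n ∈ Finset.range N, (f ((z (k + n)).1) - f ((z (k + n)).2))|) ∂P ≤
      1 + (Real.exp (l * (c - a)) - 1) * ((1 - (w x₀)⁻¹) ^ k * μ₀.real (Set.diagonal Ω)ᶜ /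
        (1 - Real.exp (l * (c - a)) * (1 - (w x₀)⁻¹))) := fun N => by
    rw [hP]; exact crnLag_integral_exp_abs_correction_le hw hw0 hmax Khat hK μ₀ hf ha hc k N hl hlr
  -- a.e. the truncated corrections converge to the untruncated one, hence so do the exponentials
  have hae : ∀ᵐ z ∂P, ENNReal.ofReal (Real.exp (l * |∑' n, (f ((z (k + n)).1) - f ((z (k + n)).2))|)) =
      liminf (fun N => ENNReal.ofReal (Real.exp (l * |∑ n ∈ Finset.range N, (f ((z (k + n)).1) - f ((z (k + n)).2))|))) atTop := by
    filter_upwards [crnLag_ae_summable_corrections hw hw0 hmax Khat hK μ₀ f k] with z hz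
    have h := hz.hasSum.tendsto_sum_nat
    exact ((ENNReal.continuous_ofReal.tendsto _).comp
      ((Real.continuous_exp.tendsto _).comp ((h.abs).const_mul l))).liminf_eq.symm
  rw [lintegral_congr_ae hae]
  refine (lintegral_liminf_le fun N => ENNReal.measurable_ofReal.comp (hEm N)).trans ?_
  refine liminf_le_of_frequently_le' (Frequently.of_forall fun N => ?_)
  show ∫⁻ z, ENNReal.ofReal (Real.exp (l * |∑ n ∈ Finset.range N, (f ((z (k + n)).1) - f ((z (k + n)).2))|)) ∂P ≤ _
  rw [← ofReal_integral_eq_lintegral_ofReal (hEi N) (ae_of_all _ fun z => Real.exp_nonneg _)]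
  exact ENNReal.ofReal_le_ofReal (hbound N)

/-- **`exp(λ|H_k − f(Y_k)|)` IS INTEGRABLE** for `λ ≥ 0` with `e^{λ(c−a)} r < 1`: the untruncated correction has finite exponential
moments of every order `λ < log(1/r)/(c − a)`, from every initial coupling. [ours] -/
theorem crnLag_exp_abs_tsum_correction_integrable [MeasurableEq Ω] (hw : Measurable w) (hw0 : ∀ y, 0 < w y) {x₀ : Ω}
    (hmax : ∀ y, w y ≤ w x₀) [IsProbabilityMeasure (q.withDensity fun y => ENNReal.ofReal (w y))]
    (Khat : Kernel (Ω × Ω) (Ω × Ω)) [IsMarkovKernel Khat]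
    (hK : ∀ z : Ω × Ω, Khat z = (q.prod (volume : Measure unitInterval)).map (fun p : Ω × unitInterval =>
      ((if (p.2 : ℝ) * w z.1 ≤ w p.1 then p.1 else z.1), (if (p.2 : ℝ) * w z.2 ≤ w p.1 then p.1 else z.2))))
    (μ₀ : Measure (Ω × Ω)) [IsProbabilityMeasure μ₀] {f : Ω → ℝ} (hf : Measurable f) {a c : ℝ} (ha : ∀ x, a ≤ f x)
    (hc : ∀ x, f x ≤ c) (k : ℕ) {l : ℝ} (hl : 0 ≤ l) (hlr : Real.exp (l * (c - a)) * (1 - (w x₀)⁻¹) < 1) :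
    Integrable (fun z : ℕ → Ω × Ω => Real.exp (l * |∑' n, (f ((z (k + n)).1) - f ((z (k + n)).2))|))
      (Kernel.trajMeasure (X := fun _ : ℕ => Ω × Ω) μ₀
        (fun n : ℕ => Khat.comap (fun h : (i : ↥(Finset.Iic n)) → Ω × Ω => h ⟨n, Finset.mem_Iic.2 le_rfl⟩)
          (measurable_pi_apply _))) := by
  set P := Kernel.trajMeasure (X := fun _ : ℕ => Ω × Ω) μ₀
      (fun n : ℕ => Khat.comap (fun h : (i : ↥(Finset.Iic n)) → Ω × Ω => h ⟨n, Finset.mem_Iic.2 le_rfl⟩)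
        (measurable_pi_apply _)) with hP
  have hEm : ∀ N, Measurable fun z : ℕ → Ω × Ω =>
      Real.exp (l * |∑ n ∈ Finset.range N, (f ((z (k + n)).1) - f ((z (k + n)).2))|) := fun N =>
    measurable_exp_abs_sum_corrections hf k N l
  have hasm : AEStronglyMeasurable
      (fun z : ℕ → Ω × Ω => Real.exp (l * |∑' n, (f ((z (k + n)).1) - f ((z (k + n)).2))|)) P := by
    refine aestronglyMeasurable_of_tendsto_ae atTop (fun N => (hEm N).aestronglyMeasurable) ?_
    filter_upwards [crnLag_ae_summable_corrections hw hw0 hmax Khat hK μ₀ f k] with z hz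
    exact (Real.continuous_exp.tendsto _).comp ((hz.hasSum.tendsto_sum_nat.abs).const_mul l)
  refine ⟨hasm, ?_⟩
  rw [hasFiniteIntegral_iff_ofReal (ae_of_all _ fun z => Real.exp_nonneg _)]
  exact (crnLag_lintegral_exp_abs_tsum_correction_le hw hw0 hmax Khat hK μ₀ hf ha hc k hl hlr).trans_lt ENNReal.ofReal_lt_top

/-- **EXPONENTIAL MOMENTS OF THE UNTRUNCATED CORRECTION `H_k − f(Y_k) = Σ_{n≥0} D_{k+n}`**: for `λ ≥ 0` with `e^{λ(c−a)} r < 1`,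
`E[exp(λ|H_k − f(Y_k)|)] ≤ 1 + (e^{λ(c−a)} − 1)·r^k·P(X_0 ≠ X′_0)/(1 − e^{λ(c−a)} r)`, from every initial coupling. [ours] -/
theorem crnLag_integral_exp_abs_tsum_correction_le [MeasurableEq Ω] (hw : Measurable w) (hw0 : ∀ y, 0 < w y) {x₀ : Ω}
    (hmax : ∀ y, w y ≤ w x₀) [IsProbabilityMeasure (q.withDensity fun y => ENNReal.ofReal (w y))]
    (Khat : Kernel (Ω × Ω) (Ω × Ω)) [IsMarkovKernel Khat]
    (hK : ∀ z : Ω × Ω, Khat z = (q.prod (volume : Measure unitInterval)).map (fun p : Ω × unitInterval =>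
      ((if (p.2 : ℝ) * w z.1 ≤ w p.1 then p.1 else z.1), (if (p.2 : ℝ) * w z.2 ≤ w p.1 then p.1 else z.2))))
    (μ₀ : Measure (Ω × Ω)) [IsProbabilityMeasure μ₀] {f : Ω → ℝ} (hf : Measurable f) {a c : ℝ} (ha : ∀ x, a ≤ f x)
    (hc : ∀ x, f x ≤ c) (k : ℕ) {l : ℝ} (hl : 0 ≤ l) (hlr : Real.exp (l * (c - a)) * (1 - (w x₀)⁻¹) < 1) :
    ∫ z, Real.exp (l * |∑' n, (f ((z (k + n)).1) - f ((z (k + n)).2))|)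
        ∂(Kernel.trajMeasure (X := fun _ : ℕ => Ω × Ω) μ₀
          (fun n : ℕ => Khat.comap (fun h : (i : ↥(Finset.Iic n)) → Ω × Ω => h ⟨n, Finset.mem_Iic.2 le_rfl⟩)
            (measurable_pi_apply _))) ≤
      1 + (Real.exp (l * (c - a)) - 1) * ((1 - (w x₀)⁻¹) ^ k * μ₀.real (Set.diagonal Ω)ᶜ /
        (1 - Real.exp (l * (c - a)) * (1 - (w x₀)⁻¹))) := by
  have hca : 0 ≤ c - a := by linarith [ha x₀, hc x₀]
  have hs : 1 ≤ Real.exp (l * (c - a)) := Real.one_le_exp (mul_nonneg hl hca)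
  have hW : 1 ≤ w x₀ := one_le_of_mode (q := q) hmax
  have hr0 : 0 ≤ 1 - (w x₀)⁻¹ := sub_nonneg.2 (inv_le_one_of_one_le₀ hW)
  have hB0 : 0 ≤ 1 + (Real.exp (l * (c - a)) - 1) * ((1 - (w x₀)⁻¹) ^ k * μ₀.real (Set.diagonal Ω)ᶜ /
      (1 - Real.exp (l * (c - a)) * (1 - (w x₀)⁻¹))) :=
    add_nonneg zero_le_one (mul_nonneg (sub_nonneg.2 hs)
      (div_nonneg (mul_nonneg (pow_nonneg hr0 k) measureReal_nonneg) (sub_nonneg.2 hlr.le)))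
  have hI := crnLag_exp_abs_tsum_correction_integrable hw hw0 hmax Khat hK μ₀ hf ha hc k hl hlr
  have hL := crnLag_lintegral_exp_abs_tsum_correction_le hw hw0 hmax Khat hK μ₀ hf ha hc k hl hlr
  rw [integral_eq_lintegral_of_nonneg_ae (ae_of_all _ fun z => Real.exp_nonneg _) hI.aestronglyMeasurable]
  exact (ENNReal.toReal_mono ENNReal.ofReal_ne_top hL).trans_eq (ENNReal.toReal_ofReal hB0)

end Summit.Ventures.LatticeQCDFlow.Exactness

end
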